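import Literature.Analysis.Complex.JensenPolynomialEffectiveConvergence
import Literature.Analysis.Complex.ArgumentPrincipleWinding
import Mathlib.Analysis.SpecialFunctions.Stirling
import Mathlib.Analysis.SpecialFunctions.Integrals.Basic
import Mathlib.MeasureTheory.Integral.IntervalIntegral.Basic
import HarnessLib

/-!
# The exact circle kernel of the scaled Jensen polynomial `J^{d,0}_γ(z/d)`, I: the kernel, its
# Gaussian bound, its Fourier moments, and the representation (all proved)

Trunk T-CA (`Literature/Analysis/Complex`), namespace `Literature.Analysis.Complex.JensenCircleKernel`;
continues `JensenPolynomialEffectiveConvergence.lean` (effective Craven–Csordas, GLOBAL majorant).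
For an entire `F(w) = Σ γⱼ wʲ/j!` (majorant summable) and `d ≥ 1` the scaled Jensen polynomial
(`Literature.NumberTheory.LFunctions.jensenPoly`, [GORZPNAS2019, §1]) is an exact circle average:

  `J^{d,0}_γ(z/d) = ∫_{-π}^{π} F(z e^{iτ}) K_d(τ) dτ`,  `K_d(τ) = d!·exp(d e^{iτ} − i d τ)/(2π dᵈ)`

(`integral_mul_jensenKernel_eq`) — the Appell/Jensen contour integral
`A_{n,f}(z) = (n!/2πi)∮ f(x)e^{xz}x^{-n-1}dx` [CampbellJalowy2026, p. 9] read on the circle of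
radius `|z|` and rescaled `w ↦ w/d`. The kernel has Fourier moments
`∫ e^{ikτ}K_d(τ)dτ = u_d(k) = d(d-1)⋯(d-k+1)/dᵏ` (`integral_cexp_pow_mul_jensenKernel`; in particular
`u_d(0) = u_d(1) = 1`: `integral_jensenKernel`, `integral_cexp_mul_jensenKernel`) and modulus
`|K_d(τ)| = d! e^{d cos τ}/(2π dᵈ) ≤ K_d(0)·e^{−2dτ²/π²}` (`norm_jensenKernel`, `norm_jensenKernel_le`),
`K_d(0) = jensenKernelPeak d = d! eᵈ/(2π dᵈ) ≤ e√d/(2π)` (`jensenKernelPeak_le`, Stirling) — a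
GAUSSIAN LENS of angular width `≍ 1/√d`. Part II (`JensenPolynomialCircleKernelDetection.lean`)
draws the local error functional and the isolation-free detection criterion from it.

## Contents (all proved; definitions `uFactor`, `jensenKernel`, `jensenKernelPeak`)
* `uFactor d j = d.descFactorial j / dʲ` and its values; `hasSum_jensenPoly_scaled`.
* `jensenKernel`, `jensenKernelPeak`, `norm_jensenKernel`, `norm_jensenKernel_le`,
  `norm_jensenKernel_le_peak`, `jensenKernelPeak_le`.
* `integral_cexp_pow_mul_jensenKernel`, `integral_jensenKernel`, `integral_cexp_mul_jensenKernel`.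
* `integral_mul_jensenKernel_eq` — the representation.

Provenance: cell rh-jensen (D-0074 GROUP I, negation lens round 3, `NegationLensR3Sketch.lean`
§§1–5c, planner-rh-jensen-idea-2-g3-0, 2026-08-26; farm rc 0, sorry-free), landed by
prover-rh-jensen-eng-2-g2-0 (WANTED W1 of that seat). AI-produced formalisation; AI review is weaker
than expert review. RH-free: everything is analysis of an arbitrary real sequence `γ` / entire `F`;
nothing here concerns `ξ` or bears on the truth of RH.

## References
* [CampbellJalowy2026] A. Campbell, J. Jalowy, *Pólya–Schur problems and free probability*,
  arXiv:2605.31356 (2026), p. 9: the contour (saddle-point) representation of the Appell polynomials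
  `A_{n,f}(z) = (n!/2πi)∮_Γ f(x)e^{xz}x^{-n-1}dx` (classical); read on the circle `|x| = |z|` after
  `w ↦ w/d` it is the kernel representation below.
* [CravenCsordas1989] T. Craven, G. Csordas, Pacific J. Math. 136 (1989) 241–260, Lemma 2.2 (the
  qualitative `J^{d,0}_γ(z/d) → F(z)`; its proof's multipliers `u_d(k) = d!/((d−k)! dᵏ)`).
* [Conway1978] J. B. Conway, *Functions of One Complex Variable I*, Ch. IV §2 (Taylor), Ch. V §3
  (Rouché / argument principle; tree: `Literature.Analysis.Complex.ArgumentPrincipleWinding`).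
* [GORZPNAS2019] M. Griffin, K. Ono, L. Rolen, D. Zagier, PNAS 116 (2019) 11103–11110, §1 (`J^{d,n}_γ`).
-/

noncomputable section

open Polynomial Complex Filter Topology Metric Set MeasureTheory intervalIntegral
open scoped ComplexConjugate Nat Real

namespace Literature.Analysis.Complex.JensenCircleKernel

open Literature.NumberTheory.LFunctions Literature.Analysis.Complex.PolyaSchur
  Literature.Analysis.Complex Literature.Topology.PlaneTopology

/-! ## §1 The scaled Jensen multipliers `u_d(j)` -/

/-- `u_d(j) = d(d-1)⋯(d-j+1)/dʲ` (`= 0` for `j > d`; `u_d(0) = u_d(1) = 1`).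
[cite: CravenCsordas1989, proof of Lemma 2.2 (the multipliers u_d(k))] -/
def uFactor (d j : ℕ) : ℝ := (d.descFactorial j : ℝ) / (d : ℝ) ^ j
/-- `u_d(0) = 1`. [cite: CravenCsordas1989, proof of Lemma 2.2] -/
theorem uFactor_zero (d : ℕ) : uFactor d 0 = 1 := by simp [uFactor]
/-- `u_d(1) = 1` for `d ≥ 1`. [cite: CravenCsordas1989, proof of Lemma 2.2] -/
theorem uFactor_one {d : ℕ} (hd : 0 < d) : uFactor d 1 = 1 := by
  have : (d : ℝ) ≠ 0 := by exact_mod_cast hd.ne'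
  simp [uFactor, this]
/-- `u_d(j) = 0` for `j > d`. [cite: CravenCsordas1989, proof of Lemma 2.2] -/
theorem uFactor_eq_zero_of_lt {d j : ℕ} (h : d < j) : uFactor d j = 0 := by
  simp [uFactor, Nat.descFactorial_eq_zero_iff_lt.2 h]

/-- For `k ≤ d`: `u_d(k) = d!/((d-k)! dᵏ)`. [cite: CravenCsordas1989, proof of Lemma 2.2] -/
theorem uFactor_eq_of_le {d k : ℕ} (hk : k ≤ d) :
    uFactor d k = (d ! : ℝ) / (((d - k)! : ℝ) * (d : ℝ) ^ k) := by
  have h := Nat.factorial_mul_descFactorial hk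
  have h' : ((d - k)! : ℝ) * (d.descFactorial k : ℝ) = (d ! : ℝ) := by exact_mod_cast h
  have hf : ((d - k)! : ℝ) ≠ 0 := by exact_mod_cast Nat.factorial_ne_zero _
  rw [uFactor, ← h']
  field_simp

/-- `J^{d,0}_γ(z/d) = Σⱼ u_d(j) γⱼ zʲ/j!` (finite sum written as a `HasSum`): the tree's
`Literature.Analysis.Complex.JensenDetection.hasSum_jensenPoly_scaled` (landed from round 2), restated
with the abbreviation `uFactor`. [cite: CravenCsordas1989, proof of Lemma 2.2] -/
theorem hasSum_jensenPoly_scaled (γ : ℕ → ℝ) {d : ℕ} (hd : 0 < d) (z : ℂ) :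
    HasSum (fun j => ((uFactor d j : ℝ) : ℂ) * ((γ j : ℂ) / (j ! : ℂ) * z ^ j))
      (aeval (z / d) (jensenPoly γ d 0)) :=
  Literature.Analysis.Complex.JensenDetection.hasSum_jensenPoly_scaled γ hd z

/-! ## §2 The Jensen circle kernel and its Gaussian bound -/

/-- The Jensen circle kernel `K_d(τ) = d! · exp(d e^{iτ} − i d τ) / (2π dᵈ)`.
[cite: CampbellJalowy2026, p. 9 (contour representation of the Appell polynomials, on the circle |x| = |z|)] -/
def jensenKernel (d : ℕ) (τ : ℝ) : ℂ :=
  (d ! : ℂ) / (2 * π * (d : ℂ) ^ d) * exp ((d : ℂ) * exp (τ * I) - (d : ℂ) * τ * I)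

/-- Its peak value `K_d(0) = d! eᵈ/(2π dᵈ)`. [cite: CampbellJalowy2026, p. 9] -/
def jensenKernelPeak (d : ℕ) : ℝ := (d ! : ℝ) / (2 * π * (d : ℝ) ^ d) * Real.exp d
/-- The Jensen circle kernel is continuous in the angle. [cite: CampbellJalowy2026, p. 9] -/
@[fun_prop]
theorem continuous_jensenKernel (d : ℕ) : Continuous fun τ : ℝ => jensenKernel d τ := by
  unfold jensenKernel; fun_prop
/-- Norm of the kernel's constant `d!/(2π dᵈ)`. [folklore] -/
private theorem norm_jensenKernel_coeff (d : ℕ) :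
    ‖(d ! : ℂ) / (2 * π * (d : ℂ) ^ d)‖ = (d ! : ℝ) / (2 * π * (d : ℝ) ^ d) := by
  rw [norm_div, norm_mul, norm_mul, norm_pow, Complex.norm_natCast, Complex.norm_natCast,
    Complex.norm_real, Real.norm_eq_abs, abs_of_pos Real.pi_pos, Complex.norm_ofNat]

/-- `|K_d(τ)| = d! e^{d cos τ}/(2π dᵈ)`.
[cite: CampbellJalowy2026, p. 9 (modulus of the saddle-point kernel)] -/
theorem norm_jensenKernel (d : ℕ) (τ : ℝ) :
    ‖jensenKernel d τ‖ = (d ! : ℝ) / (2 * π * (d : ℝ) ^ d) * Real.exp (d * Real.cos τ) := by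
  have hre : ((d : ℂ) * exp (τ * I) - (d : ℂ) * τ * I).re = d * Real.cos τ := by
    simp [Complex.exp_ofReal_mul_I_re]
  rw [jensenKernel, norm_mul, Complex.norm_exp, hre, norm_jensenKernel_coeff]

/-- Jordan: `cos τ ≤ 1 − 2τ²/π²` on `[-π, π]`. [folklore] -/
private theorem cos_le_one_sub_sq {τ : ℝ} (hτ : |τ| ≤ π) : Real.cos τ ≤ 1 - 2 / π ^ 2 * τ ^ 2 := by
  have hπ := Real.pi_pos
  have h0 : 0 ≤ |τ| / 2 := by positivity
  have h1 : |τ| / 2 ≤ π / 2 := by linarith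
  have hj := Real.mul_le_sin h0 h1
  have hcos : Real.cos τ = 1 - 2 * Real.sin (|τ| / 2) ^ 2 := by
    rw [← Real.cos_abs τ]
    have h2 := Real.cos_two_mul (|τ| / 2)
    have h3 := Real.sin_sq_add_cos_sq (|τ| / 2)
    rw [show 2 * (|τ| / 2) = |τ| by ring] at h2
    linarith
  have hs0 : 0 ≤ 2 / π * (|τ| / 2) := by positivity
  have hsq : (2 / π * (|τ| / 2)) ^ 2 ≤ Real.sin (|τ| / 2) ^ 2 := pow_le_pow_left₀ hs0 hj 2
  have : (2 / π * (|τ| / 2)) ^ 2 = τ ^ 2 / π ^ 2 := by rw [mul_pow, div_pow, div_pow, sq_abs]; ring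
  rw [this] at hsq
  rw [hcos]
  have : 2 / π ^ 2 * τ ^ 2 = 2 * (τ ^ 2 / π ^ 2) := by ring
  rw [this]
  linarith

/-- **Gaussian bound**: `|K_d(τ)| ≤ K_d(0) · e^{−2dτ²/π²}` for `|τ| ≤ π`.
[cite: CampbellJalowy2026, p. 9 (Gaussian localisation of the kernel)] -/
theorem norm_jensenKernel_le (d : ℕ) {τ : ℝ} (hτ : |τ| ≤ π) :
    ‖jensenKernel d τ‖ ≤ jensenKernelPeak d * Real.exp (-(2 * d / π ^ 2) * τ ^ 2) := by
  rw [norm_jensenKernel]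
  have hc : 0 ≤ (d ! : ℝ) / (2 * π * (d : ℝ) ^ d) := by positivity
  have h1 : (d : ℝ) * Real.cos τ ≤ d * (1 - 2 / π ^ 2 * τ ^ 2) :=
    mul_le_mul_of_nonneg_left (cos_le_one_sub_sq hτ) (Nat.cast_nonneg d)
  calc (d ! : ℝ) / (2 * π * (d : ℝ) ^ d) * Real.exp (d * Real.cos τ)
      ≤ (d ! : ℝ) / (2 * π * (d : ℝ) ^ d) * Real.exp (d * (1 - 2 / π ^ 2 * τ ^ 2)) := by
        gcongr
    _ = jensenKernelPeak d * Real.exp (-(2 * d / π ^ 2) * τ ^ 2) := by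
        rw [show (d : ℝ) * (1 - 2 / π ^ 2 * τ ^ 2) = d + -(2 * d / π ^ 2) * τ ^ 2 by ring,
          Real.exp_add, jensenKernelPeak]
        ring

/-- `|K_d(τ)| ≤ K_d(0)` for every `τ`. [cite: CampbellJalowy2026, p. 9] -/
theorem norm_jensenKernel_le_peak (d : ℕ) (τ : ℝ) : ‖jensenKernel d τ‖ ≤ jensenKernelPeak d := by
  rw [norm_jensenKernel, jensenKernelPeak]
  have hc : 0 ≤ (d ! : ℝ) / (2 * π * (d : ℝ) ^ d) := by positivity
  gcongr
  have := Real.cos_le_one τ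
  have hd : (0 : ℝ) ≤ d := Nat.cast_nonneg d
  nlinarith

/-- **Stirling**: `K_d(0) = d! eᵈ/(2π dᵈ) ≤ e√d/(2π)` (`d ≥ 1`), from the monotonicity of
Mathlib's `Stirling.stirlingSeq`.
[cite: CampbellJalowy2026, p. 9 (Stirling for the peak value)] -/
theorem jensenKernelPeak_le {d : ℕ} (hd : 0 < d) :
    jensenKernelPeak d ≤ Real.exp 1 * Real.sqrt d / (2 * π) := by
  obtain ⟨n, rfl⟩ : ∃ n, d = n + 1 := ⟨d - 1, by omega⟩
  have hmono := Stirling.stirlingSeq'_antitone (Nat.zero_le n)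
  simp only [Function.comp_apply, Nat.succ_eq_add_one, zero_add, Stirling.stirlingSeq_one] at hmono
  -- hmono : stirlingSeq (n+1) ≤ exp 1 / √2
  rw [Stirling.stirlingSeq] at hmono
  set m : ℕ := n + 1 with hm
  have hm0 : (0 : ℝ) < m := by exact_mod_cast hd
  have hpos : 0 < Real.sqrt (2 * m) * ((m : ℝ) / Real.exp 1) ^ m := by positivity
  rw [div_le_iff₀ hpos] at hmono
  have hsq : Real.sqrt (2 * (m : ℝ)) = Real.sqrt 2 * Real.sqrt m :=
    Real.sqrt_mul (by norm_num) _
  have h2 : Real.sqrt 2 ≠ 0 := by positivity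
  have hpow : ((m : ℝ) / Real.exp 1) ^ m = (m : ℝ) ^ m / Real.exp m := by
    rw [div_pow, Real.exp_one_pow]
  rw [hsq, hpow] at hmono
  -- hmono : m! ≤ exp 1 / √2 * (√2 * √m * (m^m / exp m))
  have hmono' : (m ! : ℝ) * Real.exp m ≤ Real.exp 1 * Real.sqrt m * (m : ℝ) ^ m := by
    have hexp : 0 < Real.exp m := Real.exp_pos _
    have : Real.exp 1 / Real.sqrt 2 * (Real.sqrt 2 * Real.sqrt m * ((m : ℝ) ^ m / Real.exp m))
        = Real.exp 1 * Real.sqrt m * (m : ℝ) ^ m / Real.exp m := by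
      field_simp
    rw [this, le_div_iff₀ hexp] at hmono
    exact hmono
  rw [jensenKernelPeak, div_mul_eq_mul_div, div_le_div_iff₀ (by positivity) (by positivity)]
  have hπ := Real.pi_pos
  have hmm : (0 : ℝ) < (m : ℝ) ^ m := by positivity
  nlinarith [mul_le_mul_of_nonneg_right hmono' (by positivity : (0 : ℝ) ≤ 2 * π)]

/-! ## §3 Fourier moments of the kernel -/

/-- `∫_{-π}^{π} e^{inτ} dτ = 2π·[n = 0]` for an integer `n`. [folklore] -/
private theorem integral_cexp_int_mul (n : ℤ) :
    ∫ τ in (-π)..π, exp ((n : ℂ) * τ * I) = if n = 0 then (2 * π : ℂ) else 0 := by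
  split_ifs with hn
  · subst hn
    have : (fun τ : ℝ => exp (((0 : ℤ) : ℂ) * τ * I)) = fun _ => (1 : ℂ) := by
      funext τ; simp
    rw [this, intervalIntegral.integral_const, Complex.real_smul, mul_one]
    push_cast; ring
  · have hc : (n : ℂ) * I ≠ 0 := mul_ne_zero (by exact_mod_cast hn) I_ne_zero
    have h2 : (fun τ : ℝ => exp ((n : ℂ) * τ * I)) = fun τ : ℝ => exp ((n : ℂ) * I * τ) := by
      funext τ; congr 1; ring
    rw [h2, integral_exp_mul_complex hc, div_eq_zero_iff]
    left
    rw [sub_eq_zero]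
    have : (n : ℂ) * I * ((π : ℝ) : ℂ) = (n : ℂ) * I * ((-π : ℝ) : ℂ) + n * (2 * π * I) := by
      push_cast; ring
    rw [this, Complex.exp_add, Complex.exp_int_mul_two_pi_mul_I, mul_one]
/-- `(e^{iτ})ⁿ = e^{inτ}`. [folklore] -/
private theorem cexp_pow_eq (τ : ℝ) (n : ℕ) : exp (τ * I) ^ n = exp ((n : ℂ) * τ * I) := by
  rw [← Complex.exp_nat_mul]; congr 1; ring

/-- **Moments of the kernel**: `∫_{-π}^{π} e^{ikτ} K_d(τ) dτ = u_d(k)` (`= 0` for `k > d`).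
[cite: CampbellJalowy2026, p. 9 (coefficient extraction)] [cite: CravenCsordas1989, proof of Lemma 2.2] -/
theorem integral_cexp_pow_mul_jensenKernel {d : ℕ} (hd : 0 < d) (k : ℕ) :
    ∫ τ in (-π)..π, exp (τ * I) ^ k * jensenKernel d τ = (uFactor d k : ℂ) := by
  set c : ℂ := (d ! : ℂ) / (2 * π * (d : ℂ) ^ d) with hc
  set G : ℕ → ℝ → ℂ := fun m τ =>
    c * ((d : ℂ) ^ m / (m ! : ℂ)) * exp (((((k + m : ℕ) : ℤ) - (d : ℤ) : ℤ) : ℂ) * τ * I) with hG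
  -- pointwise expansion of the integrand
  have hlim : ∀ τ : ℝ, HasSum (fun m => G m τ) (exp (τ * I) ^ k * jensenKernel d τ) := by
    intro τ
    have h := NormedSpace.expSeries_div_hasSum_exp ((d : ℂ) * exp (τ * I))
    rw [← Complex.exp_eq_exp_ℂ] at h
    have h2 := h.mul_left (c * exp (τ * I) ^ k * exp (-((d : ℂ) * τ * I)))
    have h3 : (fun m => G m τ) = fun i =>
        c * exp (τ * I) ^ k * exp (-((d : ℂ) * τ * I)) * (((d : ℂ) * exp (τ * I)) ^ i / (i ! : ℂ)) := by
      funext m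
      simp only [hG]
      have he : exp (((((k + m : ℕ) : ℤ) - (d : ℤ) : ℤ) : ℂ) * τ * I)
          = exp (τ * I) ^ k * exp (-((d : ℂ) * τ * I)) * exp (τ * I) ^ m := by
        rw [cexp_pow_eq, cexp_pow_eq, ← Complex.exp_add, ← Complex.exp_add]
        congr 1; push_cast; ring
      rw [he, mul_pow]; ring
    have h4 : exp (τ * I) ^ k * jensenKernel d τ =
        c * exp (τ * I) ^ k * exp (-((d : ℂ) * τ * I)) * exp ((d : ℂ) * exp (τ * I)) := by
      rw [jensenKernel, ← hc, sub_eq_add_neg, Complex.exp_add]; ring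
    rw [h3, h4]; exact h2
  -- dominated convergence
  have hDCT : HasSum (fun m => ∫ τ in (-π)..π, G m τ)
      (∫ τ in (-π)..π, exp (τ * I) ^ k * jensenKernel d τ) := by
    refine intervalIntegral.hasSum_integral_of_dominated_convergence
      (fun m _ => ‖c‖ * ((d : ℝ) ^ m / (m ! : ℝ)))
      (fun m => Continuous.aestronglyMeasurable (by simp only [hG]; fun_prop))
      (fun m => ae_of_all _ fun τ _ => ?_) (ae_of_all _ fun τ _ => ?_) intervalIntegrable_const
      (ae_of_all _ fun τ _ => hlim τ)
    · simp only [hG, norm_mul, Complex.norm_exp, norm_div, norm_pow, Complex.norm_natCast]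
      have : ((((((k + m : ℕ) : ℤ) - (d : ℤ) : ℤ) : ℂ) * τ * I).re) = 0 := by simp
      rw [this, Real.exp_zero, mul_one]
    · exact (Real.summable_pow_div_factorial (d : ℝ)).mul_left ‖c‖
  -- the termwise integrals
  have hGi : ∀ m : ℕ, ∫ τ in (-π)..π, G m τ =
      c * ((d : ℂ) ^ m / (m ! : ℂ)) * (if (((k + m : ℕ) : ℤ) - (d : ℤ) : ℤ) = 0 then (2 * π : ℂ) else 0) := by
    intro m
    simp only [hG]
    rw [intervalIntegral.integral_const_mul, integral_cexp_int_mul]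
  by_cases hk : k ≤ d
  · -- only `m = d - k` survives
    have hval : HasSum (fun m => ∫ τ in (-π)..π, G m τ) (uFactor d k : ℂ) := by
      have hzero : ∀ m, m ≠ d - k → (∫ τ in (-π)..π, G m τ) = 0 := by
        intro m hm
        rw [hGi m, if_neg (by omega), mul_zero]
      convert hasSum_single (d - k) hzero using 1
      rw [hGi (d - k), if_pos (by omega), uFactor_eq_of_le hk, hc]
      have hd0 : (d : ℂ) ≠ 0 := by exact_mod_cast hd.ne'
      have hf1 : ((d - k)! : ℂ) ≠ 0 := by exact_mod_cast Nat.factorial_ne_zero _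
      have hπ : (π : ℂ) ≠ 0 := by exact_mod_cast Real.pi_pos.ne'
      have hpow : (d : ℂ) ^ d = (d : ℂ) ^ (d - k) * (d : ℂ) ^ k := by
        rw [← pow_add, Nat.sub_add_cancel hk]
      push_cast
      rw [hpow]
      field_simp
    exact hDCT.unique hval
  · push Not at hk
    have hval : HasSum (fun m => ∫ τ in (-π)..π, G m τ) 0 := by
      have : (fun m => ∫ τ in (-π)..π, G m τ) = fun _ => 0 := by
        funext m; rw [hGi m, if_neg (by omega), mul_zero]
      rw [this]; exact hasSum_zero
    rw [hDCT.unique hval, uFactor_eq_zero_of_lt hk]; simp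

/-- `∫ K_d = 1`. [cite: CampbellJalowy2026, p. 9] -/
theorem integral_jensenKernel {d : ℕ} (hd : 0 < d) : ∫ τ in (-π)..π, jensenKernel d τ = 1 := by
  have h := integral_cexp_pow_mul_jensenKernel hd 0
  simp only [pow_zero, one_mul, uFactor_zero, Complex.ofReal_one] at h
  exact h

/-- `∫ e^{iτ} K_d = 1` (`d ≥ 1`). [cite: CampbellJalowy2026, p. 9] -/
theorem integral_cexp_mul_jensenKernel {d : ℕ} (hd : 0 < d) :
    ∫ τ in (-π)..π, exp (τ * I) * jensenKernel d τ = 1 := by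
  have h := integral_cexp_pow_mul_jensenKernel hd 1
  simp only [pow_one, uFactor_one hd, Complex.ofReal_one] at h
  exact h

/-! ## §4 The exact kernel representation of `J^{d,0}_γ(z/d)` -/

/-- **Exact circle-kernel representation.** If `F(w) = Σ γⱼ wʲ/j!` on `ℂ` (majorant convergent at
every radius) then for `d ≥ 1` and every `z`,
`∫_{-π}^{π} F(z e^{iτ}) K_d(τ) dτ = J^{d,0}_γ(z/d)`.
[cite: CampbellJalowy2026, p. 9 (A_{n,f}(z) = (n!/2πi)∮ f(x)e^{xz}x^{-n-1}dx, on |x| = |z|)] [cite: CravenCsordas1989, Lemma 2.2] -/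
theorem integral_mul_jensenKernel_eq {γ : ℕ → ℝ} {F : ℂ → ℂ}
    (hF : ∀ w : ℂ, HasSum (fun j => (γ j : ℂ) / (j ! : ℂ) * w ^ j) (F w))
    (hsum : ∀ R : ℝ, 0 ≤ R → Summable fun j => |γ j| / (j ! : ℝ) * R ^ j)
    {d : ℕ} (hd : 0 < d) (z : ℂ) :
    ∫ τ in (-π)..π, F (z * exp (τ * I)) * jensenKernel d τ = aeval (z / d) (jensenPoly γ d 0) := by
  set G : ℕ → ℝ → ℂ := fun j τ =>
    ((γ j : ℂ) / (j ! : ℂ) * z ^ j) * (exp (τ * I) ^ j * jensenKernel d τ) with hG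
  have hDCT : HasSum (fun j => ∫ τ in (-π)..π, G j τ)
      (∫ τ in (-π)..π, F (z * exp (τ * I)) * jensenKernel d τ) := by
    refine intervalIntegral.hasSum_integral_of_dominated_convergence
      (fun j _ => |γ j| / (j ! : ℝ) * ‖z‖ ^ j * jensenKernelPeak d)
      (fun j => Continuous.aestronglyMeasurable (by simp only [hG]; fun_prop))
      (fun j => ae_of_all _ fun τ _ => ?_) (ae_of_all _ fun τ _ => ?_) intervalIntegrable_const
      (ae_of_all _ fun τ _ => ?_)
    · simp only [hG, norm_mul, norm_div, norm_pow, Complex.norm_real, Complex.norm_natCast,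
        Real.norm_eq_abs, Complex.norm_exp_ofReal_mul_I, one_pow, one_mul]
      have h1 : 0 ≤ |γ j| / (j ! : ℝ) * ‖z‖ ^ j := by positivity
      exact mul_le_mul_of_nonneg_left (norm_jensenKernel_le_peak d τ) h1
    · exact (hsum ‖z‖ (norm_nonneg z)).mul_right _
    · have h := (hF (z * exp (τ * I))).mul_right (jensenKernel d τ)
      have h3 : (fun j => G j τ) = fun i =>
          (γ i : ℂ) / (i ! : ℂ) * (z * exp (τ * I)) ^ i * jensenKernel d τ := by
        funext j; simp only [hG, mul_pow]; ring
      rw [h3]; exact h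
  have hval : HasSum (fun j => ∫ τ in (-π)..π, G j τ) (aeval (z / d) (jensenPoly γ d 0)) := by
    convert hasSum_jensenPoly_scaled γ hd z using 1
    funext j
    simp only [hG]
    rw [intervalIntegral.integral_const_mul, integral_cexp_pow_mul_jensenKernel hd j]
    ring
  exact hDCT.unique hval

end Literature.Analysis.Complex.JensenCircleKernel
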